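import Mathlib
import HarnessLib
import Summits.HubbardSuperconductivity.HubbardSuperconductivity.Theorems.WeakCouplingBCSDefsKlThirdOrderChains

/-!
# Route `WeakCouplingBCS` — channel-margin lane of `WcbcsKohnLuttingerB1g` (stmt-HubbardSuperconductivity-0158):
# `B1g` selection to ALL orders, modulo the remainder constant `C₄` — the rows' `C4` column as a theorem

Every explicit-`U₀` row `r : KLU0Row` (`Theorems/WeakCouplingBCSDefsKlU0Record.lean`) carries, besides its certified third-order data
and the resummed chains, an ASSUMED constant `r.C4 ≥ 0`: a bound, per `U⁴` and uniformly on `0 < U ≤ U1`, of the quadratic form of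
everything in the particle–particle-irreducible Cooper vertex `Γ_U` that is NOT in `U + U² χ₀(k+k') + U³ K_res(U)` — the non-chain
diagrams of order `≥ 4` (cell file U0-TABLE.md v0 §1, §4; v3.1 §3 (iv)).  That constant is the constructive programme's output
(route `KLProgramme`, cruxes C1/C5b of the cell's DECOMP), not a certified number; the row inequality `KLU0Row.ok` already contains it
(`… + U0²(c4B + C4) < … - U0²(s4 + C4)`), but the selection theorems landed so far (`klThirdOrder_selection*`, `klResummed_selection*`)
use it only through its sign.

This file states the rows' full intended reading as a theorem.  The remainder is an ARBITRARY coupling-dependent kernel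
`R : ℝ → Momentum → Momentum → ℝ` (read: `R U = (Γ_U - U - U²χ₀(k+k') - U³K_res(U))/U⁴` restricted to the Fermi curve), entering the
vertex form divided by `U²` as `resummedForm ε₀ μ U ψ + U² ⟨ψ, R U ψ⟩`; its hypotheses are the two inequalities a bound `C4` of its form
delivers — `⟨Φ_B, R U Φ_B⟩ ≤ C4 ‖Φ_B‖²` on the record's `B1g` trial and `⟨φ, R U φ⟩ ≥ -C4` on every normalised competitor state, for
`0 < U ≤ U1` — written INLINE (no new definition).  Conclusion: for EVERY such remainder, the normalised `B1g` trial lies strictly below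
every normalised `A1g/A2g/B2g/E` state in the full form for all `0 < U ≤ r.U0`:

* `klto_row_allOrders` — the row inequality with `C4` kept, on `(0, U0]` (concavity, `klU0Row_sound`);
* `klAllOrders_bounds`, `klAllOrders_selection_of_lower`, `klAllOrders_selection(D)` — generic (any record box, any consistent row);
* `klAllOrders_selection_d010_certfloor_C4_10` (`U ≤ 1215/2²⁰`, unchanged from `C4 = 0`) and `…_C4_1000` (`U ≤ 73/2¹⁶`): at
  `δ ≈ 0.10`, modulo `klCertB1gD010.EnclosuresB1g` and the certified-floor rows' `ResummedEnclosures`, `B1g` selection survives ALL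
  orders of the pp-irreducible vertex for every remainder with form bound `10` resp. `1000` per `U⁴` on `(0, 3/10]` — at the certified
  floor the threshold is insensitive to `C4` because `U0² C4 ≪ U0 · (two-loop allowances)`.

Honest framing: `C4` is NOT certified (no fourth-order diagram is computed anywhere in the tree); the theorems are conditional on the
displayed remainder hypotheses exactly as the rows' docstrings say ASSUMED; nothing here asserts a pairing instability.

References: Raghu–Kivelson–Scalapino 2010 App. A; Scalapino–Loh–Hirsch 1986 (chains); cell files U0-TABLE.md v0 §4, v3.1 §3–§4.
-/

noncomputable section

-- the tree's namespace `Summit.<Summit>.<Problem>.Theorems` repeats the summit name by design (D-0017)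
set_option linter.dupNamespace false

namespace Summit.HubbardSuperconductivity.HubbardSuperconductivity.Theorems

open MeasureTheory Real Literature.MathematicalPhysics.QuantumLattice CwKLChiralWindow KlThirdOrder

/-! ### The row inequality with `C4` -/

/-- **A row to all orders.** If `r.ok` and `c ∈ r.chans`, then for `0 < U ≤ U0`:
`rhohi + U(c3B+tB) + U²(c4B+C4) < low - U(s3+t) - U²(s4+C4)` (`klU0Row_sound` with the polynomial envelopes themselves).
[folklore] -/
theorem klto_row_allOrders (r : KLU0Row) (hr : r.ok = true) (c : KLU0Chan) (hc : c ∈ r.chans) :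
    ∀ U : ℝ, 0 < U → U ≤ r.U0 →
      (r.rhohi : ℝ) + U * ((r.c3B : ℝ) + r.tB) + U ^ 2 * ((r.c4B : ℝ) + r.C4) <
        (c.low : ℝ) - U * ((c.s3 : ℝ) + c.t) - U ^ 2 * ((c.s4 : ℝ) + r.C4) :=
  klU0Row_sound r hr c hc (fun U => (r.rhohi : ℝ) + U * ((r.c3B : ℝ) + r.tB) + U ^ 2 * ((r.c4B : ℝ) + r.C4))
    (fun U => (c.low : ℝ) - U * ((c.s3 : ℝ) + c.t) - U ^ 2 * ((c.s4 : ℝ) + r.C4))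
    (fun _ _ _ => le_rfl) (fun _ _ _ => le_rfl)

/-! ### Two-sided bounds and selection with a remainder -/

/-- **Two-sided bounds to all orders.**  As `klResummed_bounds`, for the full form `resummedForm ε₀ μ U ψ + U² ⟨ψ, R U ψ⟩` with an
arbitrary remainder kernel `R` whose form is `≤ C4 ‖Φ_B‖²` on the `B1g` trial and `≥ -C4` on normalised competitor states (`0 < U ≤ U1`):
the normalised trial `ψ_B` obeys `full(ψ_B) ≤ rhohi + U(c3B+tB) + U²(c4B+C4)` and every normalised competitor state `φ` obeys
`low - U(s3+t) - U²(s4+C4) ≤ full(φ)`. [folklore] -/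
theorem klAllOrders_bounds {μ : ℝ} (hμ : μ ∈ Set.Ioo (-4 : ℝ) 0) (bx : KLBox) (tab : List KLTrig)
    (hritz : bx.bB1g.ritzOK tab D4Irrep.B1g = true) (hER : bx.bB1g.RitzEnclosure tab μ)
    (hlower : ∀ χ : D4Irrep, χ ≠ D4Irrep.B1g →
      (((bx.blk χ).lower tab χ : ℚ) : ℝ) ≤ channelInf (squareDispersion 1 0) μ 1 χ)
    (r : KLU0Row) (hdom : r.dominates bx tab = true)
    (h3 : r.ResummedEnclosures μ (bx.bB1g.trialFun tab))
    (R : ℝ → Momentum → Momentum → ℝ)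
    (hRB : ∀ U : ℝ, 0 < U → U ≤ r.U1 →
      kform (fermiCurveMeasure (squareDispersion 1 0) μ) (R U) (bx.bB1g.trialFun tab) ≤
        (r.C4 : ℝ) * ∫ k, bx.bB1g.trialFun tab k ^ 2 ∂fermiCurveMeasure (squareDispersion 1 0) μ)
    (hRχ : ∀ U : ℝ, 0 < U → U ≤ r.U1 → ∀ χ : D4Irrep, χ ≠ D4Irrep.B1g →
      ∀ φ : Momentum → ℝ, IsChannelState (squareDispersion 1 0) μ χ φ →
        -(r.C4 : ℝ) ≤ kform (fermiCurveMeasure (squareDispersion 1 0) μ) (R U) φ) :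
    ∃ ψ : Momentum → ℝ, IsChannelState (squareDispersion 1 0) μ D4Irrep.B1g ψ ∧
      (∀ U : ℝ, 0 < U → U ≤ r.U1 →
        resummedForm (squareDispersion 1 0) μ U ψ + U ^ 2 * kform (fermiCurveMeasure (squareDispersion 1 0) μ) (R U) ψ ≤
          (r.rhohi : ℝ) + U * ((r.c3B : ℝ) + r.tB) + U ^ 2 * ((r.c4B : ℝ) + r.C4)) ∧
      (∀ U : ℝ, 0 < U → U ≤ r.U1 → ∀ χ : D4Irrep, χ ≠ D4Irrep.B1g →
        ∀ φ : Momentum → ℝ, IsChannelState (squareDispersion 1 0) μ χ φ →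
          ((r.chanOf χ).low : ℝ) - U * (((r.chanOf χ).s3 : ℝ) + (r.chanOf χ).t) - U ^ 2 * (((r.chanOf χ).s4 : ℝ) + r.C4) ≤
            resummedForm (squareDispersion 1 0) μ U φ +
              U ^ 2 * kform (fermiCurveMeasure (squareDispersion 1 0) μ) (R U) φ) := by
  obtain ⟨hrho, -, hU1, hlow⟩ := klto_dominates_spec r bx tab hdom
  obtain ⟨h3B, h3χ⟩ := h3
  set σ := fermiCurveMeasure (squareDispersion 1 0) μ with hσ
  set Φ : Momentum → ℝ := bx.bB1g.trialFun tab with hΦ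
  obtain ⟨c, hc2, hc2N, hstate, hmean, hform2⟩ := klto_b1g_ritz_state hμ bx.bB1g tab hritz hER
  refine ⟨fun k => c * Φ k, hstate, fun U hU hUU => ?_, fun U hU hUU χ hχ φ hφ => ?_⟩
  · have h := h3B U hU hUU
    have hform3 : kform σ (klResummedKernel (squareDispersion 1 0) μ U) (fun k => c * Φ k) ≤
        ((r.c3B + r.tB : ℚ) : ℝ) + U * (r.c4B : ℝ) := by
      calc kform σ (klResummedKernel (squareDispersion 1 0) μ U) (fun k => c * Φ k)
          = c ^ 2 * kform σ (klResummedKernel (squareDispersion 1 0) μ U) Φ := kform_smul σ _ Φ c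
        _ ≤ c ^ 2 * ((((r.c3B + r.tB : ℚ) : ℝ) + U * (r.c4B : ℝ)) * ∫ k, Φ k ^ 2 ∂σ) := mul_le_mul_of_nonneg_left h hc2.le
        _ = (((r.c3B + r.tB : ℚ) : ℝ) + U * (r.c4B : ℝ)) * (c ^ 2 * ∫ k, Φ k ^ 2 ∂σ) := by ring
        _ = ((r.c3B + r.tB : ℚ) : ℝ) + U * (r.c4B : ℝ) := by rw [hc2N, mul_one]
    have hformR : kform σ (R U) (fun k => c * Φ k) ≤ (r.C4 : ℝ) := by
      calc kform σ (R U) (fun k => c * Φ k) = c ^ 2 * kform σ (R U) Φ := kform_smul σ _ Φ c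
        _ ≤ c ^ 2 * ((r.C4 : ℝ) * ∫ k, Φ k ^ 2 ∂σ) := mul_le_mul_of_nonneg_left (hRB U hU hUU) hc2.le
        _ = (r.C4 : ℝ) * (c ^ 2 * ∫ k, Φ k ^ 2 ∂σ) := by ring
        _ = (r.C4 : ℝ) := by rw [hc2N, mul_one]
    unfold resummedForm
    rw [hmean]
    have h1 : ((bx.bB1g.rhohi : ℚ) : ℝ) ≤ r.rhohi := by exact_mod_cast hrho
    have h2 : U * kform σ (klResummedKernel (squareDispersion 1 0) μ U) (fun k => c * Φ k) ≤
        U * (((r.c3B + r.tB : ℚ) : ℝ) + U * (r.c4B : ℝ)) := mul_le_mul_of_nonneg_left hform3 hU.le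
    have h2R : U ^ 2 * kform σ (R U) (fun k => c * Φ k) ≤ U ^ 2 * (r.C4 : ℝ) :=
      mul_le_mul_of_nonneg_left hformR (sq_nonneg U)
    push_cast at h2
    have h0 : (0 : ℝ) ^ 2 / U = 0 := by simp
    nlinarith [hform2]
  · have hlo2 := klto_competitor_lower hμ χ (hlower χ hχ) φ hφ
    have hlo3 := h3χ χ hχ U hU hUU φ hφ
    have hloR := hRχ U hU hUU χ hχ φ hφ
    have hlowq : (((r.chanOf χ).low : ℚ) : ℝ) ≤ ((bx.blk χ).lower tab χ : ℝ) := by exact_mod_cast hlow χ hχ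
    unfold resummedForm
    have hsq : (∫ k, φ k ∂σ) ^ 2 ≤ (∫ k, φ k ∂σ) ^ 2 / U := by
      rw [le_div_iff₀ hU]
      have hUle1 : U ≤ 1 := le_trans hUU (by exact_mod_cast hU1)
      have := sq_nonneg (∫ k, φ k ∂σ)
      nlinarith
    have h2 : U * -((((r.chanOf χ).s3 + (r.chanOf χ).t : ℚ) : ℝ) + U * ((r.chanOf χ).s4 : ℝ)) ≤
        U * kform σ (klResummedKernel (squareDispersion 1 0) μ U) φ := mul_le_mul_of_nonneg_left hlo3 hU.le
    have h2R : U ^ 2 * -(r.C4 : ℝ) ≤ U ^ 2 * kform σ (R U) φ := mul_le_mul_of_nonneg_left hloR (sq_nonneg U)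
    push_cast at h2
    nlinarith

/-- **`B1g` selection to all orders** (generic form): for every remainder kernel `R` obeying the `C4` form bounds on `(0, U1]`, the
normalised `B1g` trial lies strictly below every normalised competitor state in `resummedForm ε₀ μ U · + U² ⟨·, R U ·⟩` for all
`0 < U ≤ r.U0`. [cite: RaghuKivelsonScalapino2010, App. A] -/
theorem klAllOrders_selection_of_lower {μ : ℝ} (hμ : μ ∈ Set.Ioo (-4 : ℝ) 0) (bx : KLBox) (tab : List KLTrig)
    (hritz : bx.bB1g.ritzOK tab D4Irrep.B1g = true) (hER : bx.bB1g.RitzEnclosure tab μ)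
    (hlower : ∀ χ : D4Irrep, χ ≠ D4Irrep.B1g →
      (((bx.blk χ).lower tab χ : ℚ) : ℝ) ≤ channelInf (squareDispersion 1 0) μ 1 χ)
    (r : KLU0Row) (hr : r.ok = true) (hdom : r.dominates bx tab = true)
    (h3 : r.ResummedEnclosures μ (bx.bB1g.trialFun tab))
    (R : ℝ → Momentum → Momentum → ℝ)
    (hRB : ∀ U : ℝ, 0 < U → U ≤ r.U1 →
      kform (fermiCurveMeasure (squareDispersion 1 0) μ) (R U) (bx.bB1g.trialFun tab) ≤
        (r.C4 : ℝ) * ∫ k, bx.bB1g.trialFun tab k ^ 2 ∂fermiCurveMeasure (squareDispersion 1 0) μ)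
    (hRχ : ∀ U : ℝ, 0 < U → U ≤ r.U1 → ∀ χ : D4Irrep, χ ≠ D4Irrep.B1g →
      ∀ φ : Momentum → ℝ, IsChannelState (squareDispersion 1 0) μ χ φ →
        -(r.C4 : ℝ) ≤ kform (fermiCurveMeasure (squareDispersion 1 0) μ) (R U) φ) :
    ∃ ψ : Momentum → ℝ, IsChannelState (squareDispersion 1 0) μ D4Irrep.B1g ψ ∧
      ∀ U : ℝ, 0 < U → U ≤ r.U0 → ∀ χ : D4Irrep, χ ≠ D4Irrep.B1g →
        ∀ φ : Momentum → ℝ, IsChannelState (squareDispersion 1 0) μ χ φ →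
          resummedForm (squareDispersion 1 0) μ U ψ + U ^ 2 * kform (fermiCurveMeasure (squareDispersion 1 0) μ) (R U) ψ <
            resummedForm (squareDispersion 1 0) μ U φ + U ^ 2 * kform (fermiCurveMeasure (squareDispersion 1 0) μ) (R U) φ := by
  obtain ⟨-, hlen, -, -⟩ := klto_dominates_spec r bx tab hdom
  have hr' := hr
  simp only [KLU0Row.ok, Bool.and_eq_true, decide_eq_true_eq] at hr'
  obtain ⟨⟨⟨⟨-, hU01⟩, -⟩, -⟩, -⟩ := hr'
  obtain ⟨ψ, hψ, hup, hdown⟩ := klAllOrders_bounds hμ bx tab hritz hER hlower r hdom h3 R hRB hRχ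
  refine ⟨ψ, hψ, fun U hU hUU χ hχ φ hφ => ?_⟩
  have hUU1 : U ≤ (r.U1 : ℝ) := le_trans hUU (by exact_mod_cast hU01)
  have hrow := klto_row_allOrders r hr (r.chanOf χ) (klto_chanOf_mem r hlen χ hχ) U hU hUU
  linarith [hup U hU hUU1, hdown U hU hUU1 χ hχ φ hφ]

/-- **`B1g` selection to all orders, one box of a record passing `basicOKB1g`.** [cite: RaghuKivelsonScalapino2010, App. A] -/
theorem klAllOrders_selection {μ : ℝ} (hμ : μ ∈ Set.Ioo (-4 : ℝ) 0) (bx : KLBox) (tab : List KLTrig)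
    (hB : bx.basicOKB1g tab = true) (hER : bx.bB1g.RitzEnclosure tab μ)
    (hE : ∀ χ : D4Irrep, χ ≠ D4Irrep.B1g → (bx.blk χ).Enclosure tab μ χ)
    (r : KLU0Row) (hr : r.ok = true) (hdom : r.dominates bx tab = true)
    (h3 : r.ResummedEnclosures μ (bx.bB1g.trialFun tab))
    (R : ℝ → Momentum → Momentum → ℝ)
    (hRB : ∀ U : ℝ, 0 < U → U ≤ r.U1 →
      kform (fermiCurveMeasure (squareDispersion 1 0) μ) (R U) (bx.bB1g.trialFun tab) ≤
        (r.C4 : ℝ) * ∫ k, bx.bB1g.trialFun tab k ^ 2 ∂fermiCurveMeasure (squareDispersion 1 0) μ)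
    (hRχ : ∀ U : ℝ, 0 < U → U ≤ r.U1 → ∀ χ : D4Irrep, χ ≠ D4Irrep.B1g →
      ∀ φ : Momentum → ℝ, IsChannelState (squareDispersion 1 0) μ χ φ →
        -(r.C4 : ℝ) ≤ kform (fermiCurveMeasure (squareDispersion 1 0) μ) (R U) φ) :
    ∃ ψ : Momentum → ℝ, IsChannelState (squareDispersion 1 0) μ D4Irrep.B1g ψ ∧
      ∀ U : ℝ, 0 < U → U ≤ r.U0 → ∀ χ : D4Irrep, χ ≠ D4Irrep.B1g →
        ∀ φ : Momentum → ℝ, IsChannelState (squareDispersion 1 0) μ χ φ →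
          resummedForm (squareDispersion 1 0) μ U ψ + U ^ 2 * kform (fermiCurveMeasure (squareDispersion 1 0) μ) (R U) ψ <
            resummedForm (squareDispersion 1 0) μ U φ + U ^ 2 * kform (fermiCurveMeasure (squareDispersion 1 0) μ) (R U) φ := by
  obtain ⟨hritz, hlower⟩ := klto_lower_of_basicOKB1g hμ bx tab hB hE
  exact klAllOrders_selection_of_lower hμ bx tab hritz hER hlower r hr hdom h3 R hRB hRχ

/-- **`B1g` selection to all orders, one box of a multiplicity-aware record (`basicOKB1gD`).** [cite: RaghuKivelsonScalapino2010, App. A] -/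
theorem klAllOrders_selectionD {μ : ℝ} (hμ : μ ∈ Set.Ioo (-4 : ℝ) 0) (bx : KLBox) (tab : List KLTrig)
    (hB : bx.basicOKB1gD tab = true) (hER : bx.bB1g.RitzEnclosure tab μ)
    (hE : ∀ χ : D4Irrep, χ ≠ D4Irrep.B1g → (bx.blk χ).Enclosure tab μ χ)
    (r : KLU0Row) (hr : r.ok = true) (hdom : r.dominates bx tab = true)
    (h3 : r.ResummedEnclosures μ (bx.bB1g.trialFun tab))
    (R : ℝ → Momentum → Momentum → ℝ)
    (hRB : ∀ U : ℝ, 0 < U → U ≤ r.U1 →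
      kform (fermiCurveMeasure (squareDispersion 1 0) μ) (R U) (bx.bB1g.trialFun tab) ≤
        (r.C4 : ℝ) * ∫ k, bx.bB1g.trialFun tab k ^ 2 ∂fermiCurveMeasure (squareDispersion 1 0) μ)
    (hRχ : ∀ U : ℝ, 0 < U → U ≤ r.U1 → ∀ χ : D4Irrep, χ ≠ D4Irrep.B1g →
      ∀ φ : Momentum → ℝ, IsChannelState (squareDispersion 1 0) μ χ φ →
        -(r.C4 : ℝ) ≤ kform (fermiCurveMeasure (squareDispersion 1 0) μ) (R U) φ) :
    ∃ ψ : Momentum → ℝ, IsChannelState (squareDispersion 1 0) μ D4Irrep.B1g ψ ∧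
      ∀ U : ℝ, 0 < U → U ≤ r.U0 → ∀ χ : D4Irrep, χ ≠ D4Irrep.B1g →
        ∀ φ : Momentum → ℝ, IsChannelState (squareDispersion 1 0) μ χ φ →
          resummedForm (squareDispersion 1 0) μ U ψ + U ^ 2 * kform (fermiCurveMeasure (squareDispersion 1 0) μ) (R U) ψ <
            resummedForm (squareDispersion 1 0) μ U φ + U ^ 2 * kform (fermiCurveMeasure (squareDispersion 1 0) μ) (R U) φ := by
  obtain ⟨hritz, hlower⟩ := klto_lower_of_basicOKB1gD hμ bx tab hB hE
  exact klAllOrders_selection_of_lower hμ bx tab hritz hER hlower r hr hdom h3 R hRB hRχ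

/-! ### The `δ ≈ 0.10` point with the certified floor and `C4 ∈ {10, 1000}` -/

/-- Kernel decision: the certified-floor row with `C4 = 10` is consistent with the record `klCertB1gD010`. [folklore] -/
theorem klto_d010_certfloor_C4_10_dominates :
    (klCertB1gD010.boxes.all fun bx => klU0_d010_certfloor_nc16384_2loop_C4_10.dominates bx klCertB1gD010.trials) = true := by
  decide +kernel

/-- Kernel decision: the certified-floor row with `C4 = 1000` is consistent with the record `klCertB1gD010`. [folklore] -/
theorem klto_d010_certfloor_C4_1000_dominates :
    (klCertB1gD010.boxes.all fun bx => klU0_d010_certfloor_nc16384_2loop_C4_1000.dominates bx klCertB1gD010.trials) = true := by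
  decide +kernel

/-- **All-orders selection at `δ ≈ 0.10` from ANY consistent row** (the record's box data unpacked once). [cite: RaghuKivelsonScalapino2010, App. A] -/
theorem klAllOrders_selection_d010_of_row (hE : klCertB1gD010.EnclosuresB1g) (r : KLU0Row) (hr : r.ok = true)
    (hdom : (klCertB1gD010.boxes.all fun bx => r.dominates bx klCertB1gD010.trials) = true) :
    ∀ bx ∈ klCertB1gD010.boxes,
      r.ResummedEnclosures ((bx.mulo : ℚ) : ℝ) (bx.bB1g.trialFun klCertB1gD010.trials) →
        ∀ R : ℝ → Momentum → Momentum → ℝ,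
          (∀ U : ℝ, 0 < U → U ≤ r.U1 →
            kform (fermiCurveMeasure (squareDispersion 1 0) ((bx.mulo : ℚ) : ℝ)) (R U) (bx.bB1g.trialFun klCertB1gD010.trials) ≤
              (r.C4 : ℝ) * ∫ k, bx.bB1g.trialFun klCertB1gD010.trials k ^ 2
                ∂fermiCurveMeasure (squareDispersion 1 0) ((bx.mulo : ℚ) : ℝ)) →
          (∀ U : ℝ, 0 < U → U ≤ r.U1 → ∀ χ : D4Irrep, χ ≠ D4Irrep.B1g →
            ∀ φ : Momentum → ℝ, IsChannelState (squareDispersion 1 0) ((bx.mulo : ℚ) : ℝ) χ φ →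
              -(r.C4 : ℝ) ≤ kform (fermiCurveMeasure (squareDispersion 1 0) ((bx.mulo : ℚ) : ℝ)) (R U) φ) →
          ∃ ψ : Momentum → ℝ, IsChannelState (squareDispersion 1 0) ((bx.mulo : ℚ) : ℝ) D4Irrep.B1g ψ ∧
            ∀ U : ℝ, 0 < U → U ≤ r.U0 → ∀ χ : D4Irrep, χ ≠ D4Irrep.B1g →
              ∀ φ : Momentum → ℝ, IsChannelState (squareDispersion 1 0) ((bx.mulo : ℚ) : ℝ) χ φ →
                resummedForm (squareDispersion 1 0) ((bx.mulo : ℚ) : ℝ) U ψ +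
                    U ^ 2 * kform (fermiCurveMeasure (squareDispersion 1 0) ((bx.mulo : ℚ) : ℝ)) (R U) ψ <
                  resummedForm (squareDispersion 1 0) ((bx.mulo : ℚ) : ℝ) U φ +
                    U ^ 2 * kform (fermiCurveMeasure (squareDispersion 1 0) ((bx.mulo : ℚ) : ℝ)) (R U) φ := by
  intro bx hbx h3 R hRB hRχ
  have hall := List.all_eq_true.1 klCertB1gD010_boxes_all bx hbx
  simp only [Bool.and_eq_true] at hall
  have hB := hall.1
  have hB' := hB
  simp only [KLBox.basicOKB1g, Bool.and_eq_true, decide_eq_true_eq] at hB'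
  obtain ⟨⟨⟨⟨⟨⟨⟨h4, hle⟩, h0⟩, -⟩, -⟩, -⟩, -⟩, -⟩ := hB'
  have hμI : ((bx.mulo : ℚ) : ℝ) ∈ Set.Icc ((bx.mulo : ℚ) : ℝ) ((bx.muhi : ℚ) : ℝ) :=
    ⟨le_rfl, by exact_mod_cast hle⟩
  have hμ : ((bx.mulo : ℚ) : ℝ) ∈ Set.Ioo (-4 : ℝ) 0 :=
    ⟨by exact_mod_cast h4, lt_of_le_of_lt (by exact_mod_cast hle : ((bx.mulo : ℚ) : ℝ) ≤ bx.muhi) (by exact_mod_cast h0)⟩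
  obtain ⟨hER, hEχ⟩ := hE bx hbx _ hμI
  exact klAllOrders_selection hμ bx klCertB1gD010.trials hB hER hEχ r hr (List.all_eq_true.1 hdom bx hbx) h3 R hRB hRχ

/-- **`B1g` selection survives ALL orders of the pp-irreducible Cooper vertex at `δ ≈ 0.10` for `0 < U ≤ 1215/2²⁰`, for every non-chain
remainder of form bound `C4 = 10` per `U⁴` on `(0, 3/10]`** — modulo `klCertB1gD010.EnclosuresB1g` (item 0158's own named hypothesis) and the
certified-floor row's `klU0_d010_certfloor_nc16384_2loop_C4_10.ResummedEnclosures μ₀ Φ_B` (chains kit j247393/j247690, two-loop floor U0-TABLE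
v2 §3b); the remainder bound is the ASSUMED constructive constant (U0-TABLE v0 §4), displayed as the two explicit hypotheses on `R`.  The
threshold equals the `C4 = 0` one (`klResummed_selection_d010_certfloor`).  Existence-grade; nothing here asserts a pairing instability.
[cite: RaghuKivelsonScalapino2010, App. A] -/
theorem klAllOrders_selection_d010_certfloor_C4_10 (hE : klCertB1gD010.EnclosuresB1g) :
    ∀ bx ∈ klCertB1gD010.boxes,
      klU0_d010_certfloor_nc16384_2loop_C4_10.ResummedEnclosures ((bx.mulo : ℚ) : ℝ)
          (bx.bB1g.trialFun klCertB1gD010.trials) →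
        ∀ R : ℝ → Momentum → Momentum → ℝ,
          (∀ U : ℝ, 0 < U → U ≤ 3 / 10 →
            kform (fermiCurveMeasure (squareDispersion 1 0) ((bx.mulo : ℚ) : ℝ)) (R U) (bx.bB1g.trialFun klCertB1gD010.trials) ≤
              10 * ∫ k, bx.bB1g.trialFun klCertB1gD010.trials k ^ 2 ∂fermiCurveMeasure (squareDispersion 1 0) ((bx.mulo : ℚ) : ℝ)) →
          (∀ U : ℝ, 0 < U → U ≤ 3 / 10 → ∀ χ : D4Irrep, χ ≠ D4Irrep.B1g →
            ∀ φ : Momentum → ℝ, IsChannelState (squareDispersion 1 0) ((bx.mulo : ℚ) : ℝ) χ φ →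
              -10 ≤ kform (fermiCurveMeasure (squareDispersion 1 0) ((bx.mulo : ℚ) : ℝ)) (R U) φ) →
          ∃ ψ : Momentum → ℝ, IsChannelState (squareDispersion 1 0) ((bx.mulo : ℚ) : ℝ) D4Irrep.B1g ψ ∧
            ∀ U : ℝ, 0 < U → U ≤ 1215 / 1048576 → ∀ χ : D4Irrep, χ ≠ D4Irrep.B1g →
              ∀ φ : Momentum → ℝ, IsChannelState (squareDispersion 1 0) ((bx.mulo : ℚ) : ℝ) χ φ →
                resummedForm (squareDispersion 1 0) ((bx.mulo : ℚ) : ℝ) U ψ +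
                    U ^ 2 * kform (fermiCurveMeasure (squareDispersion 1 0) ((bx.mulo : ℚ) : ℝ)) (R U) ψ <
                  resummedForm (squareDispersion 1 0) ((bx.mulo : ℚ) : ℝ) U φ +
                    U ^ 2 * kform (fermiCurveMeasure (squareDispersion 1 0) ((bx.mulo : ℚ) : ℝ)) (R U) φ := by
  intro bx hbx h3 R hRB hRχ
  have hU1 : ((klU0_d010_certfloor_nc16384_2loop_C4_10.U1 : ℚ) : ℝ) = 3 / 10 := by
    show (((3 : ℚ) / 10 : ℚ) : ℝ) = 3 / 10
    push_cast; ring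
  have hC4 : ((klU0_d010_certfloor_nc16384_2loop_C4_10.C4 : ℚ) : ℝ) = 10 := by
    show (((10 : ℚ)) : ℝ) = 10
    push_cast; ring
  obtain ⟨ψ, hψ, h⟩ := klAllOrders_selection_d010_of_row hE _ klU0_d010_certfloor_nc16384_2loop_C4_10_ok
    klto_d010_certfloor_C4_10_dominates bx hbx h3 R
    (fun U hU hUU => by rw [hC4]; exact hRB U hU (by rw [hU1] at hUU; exact hUU))
    (fun U hU hUU χ hχ φ hφ => by rw [hC4]; exact hRχ U hU (by rw [hU1] at hUU; exact hUU) χ hχ φ hφ)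
  refine ⟨ψ, hψ, fun U hU hUU => h U hU ?_⟩
  have hU0 : klU0_d010_certfloor_nc16384_2loop_C4_10.U0 = (1215 : ℚ) / 1048576 := rfl
  rw [hU0]
  push_cast
  exact hUU

/-- **The same with remainder bound `C4 = 1000` per `U⁴`: `B1g` selection to ALL orders at `δ ≈ 0.10` for `0 < U ≤ 73/2¹⁶`** (row
`klU0_d010_certfloor_nc16384_2loop_C4_1000`; at the certified floor a hundredfold larger remainder constant costs 4 % of the threshold,
because `U0² C4 ≪ U0 × (two-loop allowances)`).  Existence-grade; `C4` ASSUMED; nothing here asserts a pairing instability.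
[cite: RaghuKivelsonScalapino2010, App. A] -/
theorem klAllOrders_selection_d010_certfloor_C4_1000 (hE : klCertB1gD010.EnclosuresB1g) :
    ∀ bx ∈ klCertB1gD010.boxes,
      klU0_d010_certfloor_nc16384_2loop_C4_1000.ResummedEnclosures ((bx.mulo : ℚ) : ℝ)
          (bx.bB1g.trialFun klCertB1gD010.trials) →
        ∀ R : ℝ → Momentum → Momentum → ℝ,
          (∀ U : ℝ, 0 < U → U ≤ 3 / 10 →
            kform (fermiCurveMeasure (squareDispersion 1 0) ((bx.mulo : ℚ) : ℝ)) (R U) (bx.bB1g.trialFun klCertB1gD010.trials) ≤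
              1000 * ∫ k, bx.bB1g.trialFun klCertB1gD010.trials k ^ 2 ∂fermiCurveMeasure (squareDispersion 1 0) ((bx.mulo : ℚ) : ℝ)) →
          (∀ U : ℝ, 0 < U → U ≤ 3 / 10 → ∀ χ : D4Irrep, χ ≠ D4Irrep.B1g →
            ∀ φ : Momentum → ℝ, IsChannelState (squareDispersion 1 0) ((bx.mulo : ℚ) : ℝ) χ φ →
              -1000 ≤ kform (fermiCurveMeasure (squareDispersion 1 0) ((bx.mulo : ℚ) : ℝ)) (R U) φ) →
          ∃ ψ : Momentum → ℝ, IsChannelState (squareDispersion 1 0) ((bx.mulo : ℚ) : ℝ) D4Irrep.B1g ψ ∧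
            ∀ U : ℝ, 0 < U → U ≤ 73 / 65536 → ∀ χ : D4Irrep, χ ≠ D4Irrep.B1g →
              ∀ φ : Momentum → ℝ, IsChannelState (squareDispersion 1 0) ((bx.mulo : ℚ) : ℝ) χ φ →
                resummedForm (squareDispersion 1 0) ((bx.mulo : ℚ) : ℝ) U ψ +
                    U ^ 2 * kform (fermiCurveMeasure (squareDispersion 1 0) ((bx.mulo : ℚ) : ℝ)) (R U) ψ <
                  resummedForm (squareDispersion 1 0) ((bx.mulo : ℚ) : ℝ) U φ +
                    U ^ 2 * kform (fermiCurveMeasure (squareDispersion 1 0) ((bx.mulo : ℚ) : ℝ)) (R U) φ := by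
  intro bx hbx h3 R hRB hRχ
  have hU1 : ((klU0_d010_certfloor_nc16384_2loop_C4_1000.U1 : ℚ) : ℝ) = 3 / 10 := by
    show (((3 : ℚ) / 10 : ℚ) : ℝ) = 3 / 10
    push_cast; ring
  have hC4 : ((klU0_d010_certfloor_nc16384_2loop_C4_1000.C4 : ℚ) : ℝ) = 1000 := by
    show (((1000 : ℚ)) : ℝ) = 1000
    push_cast; ring
  obtain ⟨ψ, hψ, h⟩ := klAllOrders_selection_d010_of_row hE _ klU0_d010_certfloor_nc16384_2loop_C4_1000_ok
    klto_d010_certfloor_C4_1000_dominates bx hbx h3 R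
    (fun U hU hUU => by rw [hC4]; exact hRB U hU (by rw [hU1] at hUU; exact hUU))
    (fun U hU hUU χ hχ φ hφ => by rw [hC4]; exact hRχ U hU (by rw [hU1] at hUU; exact hUU) χ hχ φ hφ)
  refine ⟨ψ, hψ, fun U hU hUU => h U hU ?_⟩
  have hU0 : klU0_d010_certfloor_nc16384_2loop_C4_1000.U0 = (73 : ℚ) / 65536 := rfl
  rw [hU0]
  push_cast
  exact hUU

end Summit.HubbardSuperconductivity.HubbardSuperconductivity.Theorems

end
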